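import Mathlib
import Summits.PneNP.PneNP.Theorems.CnfIdealGenLengthRankDefectRepresentationsQuadrantCapture

/-!
# Crux `RankDefectRepresentations` (stmt-PneNP-18923), line `rank-dehn-ladder`: LOCAL max-cut capture, near-by local maxima by
# hill-climbing, and antipodal superadditivity (lead g14; memo `Cruxes/RankDefectRepresentations/Lines/rank-dehn-ladder-g14.md` §2–§3)

Three elementary tools for the two-family instance `D` (rows/columns coloured by `{0,1}^n × {0,1}^{n'}`, visible iff both families' colours
differ, `doubleCut row col B B' D` = sum of the four rectangle ranks of `(B,B')`):

* `exists_blockDiagonal_of_localMaxCut` — g7's max-cut decomposition (`exists_blockDiagonal_of_maxCut`, p642852) needs the cut `B` to be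
  maximal only against SINGLE-colour moves (`B.erase i`, `insert i B`): its proof (`oneSided_decomposition`) never used more.
* `localCapture` — hence QUADRANT CAPTURE (p703363, `stub_quadrantCapture`) holds at every LOCAL maximum of the double cut: one matrix of rank
  `≤ 17·doubleCut B B'` agrees with `D` on every visible cell separated by `B` or by `B'`.
* `exists_localMax_near` — hill-climbing: from any start `(B₀,B₀')` with all double cuts `≤ c` there is a local maximum `(B,B')` with
  `#(B ∆ B₀) + #(B' ∆ B₀') ≤ c − doubleCut B₀ B₀'` (the double cut is an integer in `[0,c]` and rises by `≥ 1` per move).  So capturing double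
  cuts exist within `c` single moves of ANY prescribed pair of cuts — e.g. of a balanced one (`exists_localCapture_near`).
* `rank_quadrants_le` — ANTIPODAL SUPERADDITIVITY: for every `(B,B')` and every completion `L` of `D`,
  `rank L|₁₁ + rank L|₂₂ ≤ rank L + rank R(B,B') + rank R(Bᶜ,B'ᶜ)` (the cells between the antipodal quadrants `B×B'` and `Bᶜ×B'ᶜ` are all
  visible: they ARE the two rectangles), so `mc(D) ≥ mc(Q₁₁) + mc(Q₂₂) − doubleCut B B'`.
HONEST FRAMING: negative-lane tools; `stub_merge` / `stub_coreLinear` and the crux stay open; P ≠ NP is not moved; F-N2 is a FRONTIER formal rung.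
-/

set_option linter.dupNamespace false -- `Summit.PneNP.PneNP.…`: summit = sub-problem name (D-0017)

namespace Summit.PneNP.PneNP.Theorems.CnfIdealGenLengthRankDefectRepresentationsLocalCapture

open Matrix Finset
open Literature.Computability.AlgebraicComplexity (rank_add_le)
open Summit.PneNP.PneNP.Theorems.CnfIdealGenLengthRankDefectRepresentationsMergeLowerBound (rank_add_le' rank_sub_le')
open Summit.PneNP.PneNP.Theorems.CnfIdealGenLengthRankDefectRepresentationsCutLemmaMaxCut (oneSided_decomposition)
open Summit.PneNP.PneNP.Theorems.CnfIdealGenLengthRankDefectRepresentationsStripCompletion (rank_mask_le)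
open Summit.PneNP.PneNP.Theorems.CnfIdealGenLengthRankDefectRepresentationsTwoFamilyCutDomination
  (colourI colourJ maskJ doubleCut)
open Summit.PneNP.PneNP.Theorems.CnfIdealGenLengthRankDefectRepresentationsQuadrantCapture
  (rank_add_of_disjoint rect rect_apply cutJ_maskI_eq_doubleCut rank_sepMask_le)

variable {K : Type} [Field K]

/-! ## The max-cut decomposition at a LOCAL maximum -/

section LocalMaxCut

variable {ι ι' Q : Type} [Fintype ι] [Fintype ι'] [DecidableEq ι] [DecidableEq ι'] [DecidableEq Q] [Fintype Q]

/-- The bipartition cut `μ(B)` of a coloured matrix. -/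
noncomputable def bcut (row : ι → Q) (col : ι' → Q) (R : Matrix ι ι' K) (B : Finset Q) : ℕ :=
  (Matrix.of fun x y => if row x ∈ B ∧ col y ∉ B then R x y else 0).rank +
    (Matrix.of fun x y => if row x ∉ B ∧ col y ∈ B then R x y else 0).rank

omit [Fintype ι] [DecidableEq ι] [DecidableEq ι'] in
/-- The cut of the complement is the same cut (the two blocks are exchanged). -/
theorem bcut_compl (row : ι → Q) (col : ι' → Q) (R : Matrix ι ι' K) (B : Finset Q) :
    bcut row col R Bᶜ = bcut row col R B := by
  unfold bcut
  have e1 : (Matrix.of fun x y => if row x ∈ Bᶜ ∧ col y ∉ Bᶜ then R x y else 0) =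
      (Matrix.of fun x y => if row x ∉ B ∧ col y ∈ B then R x y else 0) := by
    ext x y; simp
  have e2 : (Matrix.of fun x y => if row x ∉ Bᶜ ∧ col y ∈ Bᶜ then R x y else 0) =
      (Matrix.of fun x y => if row x ∈ B ∧ col y ∉ B then R x y else 0) := by
    ext x y; simp
  rw [e1, e2, add_comm]

/-- **Max-cut decomposition at a LOCAL maximum.**  If no single-colour move (`B.erase i`, `insert i B`) increases the bipartition cut, then
`R` is within rank `4 μ(B)` of a matrix supported on the equal-colour cells (the proof of `exists_blockDiagonal_of_maxCut` verbatim). [folklore] -/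
theorem exists_blockDiagonal_of_localMaxCut (row : ι → Q) (col : ι' → Q) (R : Matrix ι ι' K) (B : Finset Q)
    (hdown : ∀ i, bcut row col R (B.erase i) ≤ bcut row col R B) (hup : ∀ i, bcut row col R (insert i B) ≤ bcut row col R B) :
    ∃ R' : Matrix ι ι' K, (∀ x y, row x ≠ col y → R' x y = 0) ∧ (R - R').rank ≤ 4 * bcut row col R B := by
  classical
  set Qm : Matrix ι ι' K := Matrix.of fun x y => if row x ∈ B ∧ col y ∉ B then R x y else 0 with hQm
  set Sm : Matrix ι ι' K := Matrix.of fun x y => if row x ∉ B ∧ col y ∈ B then R x y else 0 with hSm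
  set Pm : Matrix ι ι' K := Matrix.of fun x y => if row x ∈ B ∧ col y ∈ B then R x y else 0 with hPm
  set Tm : Matrix ι ι' K := Matrix.of fun x y => if row x ∈ Bᶜ ∧ col y ∈ Bᶜ then R x y else 0 with hTm
  have cQ : (Matrix.of fun x y => if row x ∈ Bᶜ ∧ col y ∉ Bᶜ then R x y else 0) = Sm := by
    ext x y; simp [hSm]
  have cS : (Matrix.of fun x y => if row x ∉ Bᶜ ∧ col y ∈ Bᶜ then R x y else 0) = Qm := by
    ext x y; simp [hQm]
  obtain ⟨P₁, hP₁s, hP₁⟩ := oneSided_decomposition row col R B (fun i _ => hdown i)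
  have hmax' : ∀ i ∈ Bᶜ,
      (Matrix.of fun x y => if row x ∈ Bᶜ.erase i ∧ col y ∉ Bᶜ.erase i then R x y else 0).rank +
        (Matrix.of fun x y => if row x ∉ Bᶜ.erase i ∧ col y ∈ Bᶜ.erase i then R x y else 0).rank ≤
      (Matrix.of fun x y => if row x ∈ Bᶜ ∧ col y ∉ Bᶜ then R x y else 0).rank +
        (Matrix.of fun x y => if row x ∉ Bᶜ ∧ col y ∈ Bᶜ then R x y else 0).rank := by
    intro i _
    have e : Bᶜ.erase i = (insert i B)ᶜ := by
      ext j; simp [Finset.mem_erase, Finset.mem_compl]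
    have h1 : bcut row col R (Bᶜ.erase i) ≤ bcut row col R Bᶜ := by
      rw [e, bcut_compl, bcut_compl]; exact hup i
    exact h1
  obtain ⟨P₂, hP₂s, hP₂⟩ := oneSided_decomposition row col R Bᶜ hmax'
  rw [cQ, cS] at hP₂
  refine ⟨P₁ + P₂, fun x y hxy => ?_, ?_⟩
  · rw [Matrix.add_apply, hP₁s x y (fun h => hxy h.1), hP₂s x y (fun h => hxy h.1), add_zero]
  have hR : R - (P₁ + P₂) = (Qm + Sm) + ((Pm - P₁) + (Tm - P₂)) := by
    have : R = Pm + Qm + Sm + Tm := by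
      ext x y
      simp only [hPm, hQm, hSm, hTm, Matrix.add_apply, Matrix.of_apply, mem_compl]
      by_cases hx : row x ∈ B <;> by_cases hy : col y ∈ B <;> simp [hx, hy]
    rw [this]; abel
  rw [hR]
  have r0 := rank_add_le (Qm + Sm) ((Pm - P₁) + (Tm - P₂))
  have r1 := rank_add_le Qm Sm
  have r2 := rank_add_le (Pm - P₁) (Tm - P₂)
  rw [← hQm, ← hSm, ← hPm] at hP₁
  rw [← hTm] at hP₂
  unfold bcut
  rw [← hQm, ← hSm]
  omega

end LocalMaxCut

/-! ## Local quadrant capture -/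

section Capture

variable {n n' : ℕ} {ι ι' : Type} [Fintype ι] [Fintype ι'] [DecidableEq ι] [DecidableEq ι']
variable (row : ι → Fin n ⊕ Fin n' → Bool) (col : ι' → Fin n ⊕ Fin n' → Bool)

/-- `(B, B')` is a LOCAL maximum of the double cut: no single-colour move in either family increases it. -/
def IsLocalMax (D : Matrix ι ι' K) (B : Finset (Fin n → Bool)) (B' : Finset (Fin n' → Bool)) : Prop :=
  (∀ i, doubleCut row col (B.erase i) B' D ≤ doubleCut row col B B' D ∧ doubleCut row col (insert i B) B' D ≤ doubleCut row col B B' D) ∧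
  (∀ j, doubleCut row col B (B'.erase j) D ≤ doubleCut row col B B' D ∧ doubleCut row col B (insert j B') D ≤ doubleCut row col B B' D)

omit [Fintype ι] [DecidableEq ι] [DecidableEq ι'] in
/-- The first-family cut of the `B'`-masked matrix is the double cut. -/
theorem bcut_maskJ (D : Matrix ι ι' K) (A : Finset (Fin n → Bool)) (B' : Finset (Fin n' → Bool)) :
    bcut (fun x => colourI (row x)) (fun y => colourI (col y)) (maskJ row col B' D) A = doubleCut row col A B' D := rfl

/-- The second-family cut of the `B`-masked matrix is the double cut. -/
theorem bcut_maskI (D : Matrix ι ι' K) (B : Finset (Fin n → Bool)) (A' : Finset (Fin n' → Bool)) :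
    bcut (fun x => colourJ (row x)) (fun y => colourJ (col y))
        (Matrix.of fun x y => if (colourI (row x) ∈ B) ≠ (colourI (col y) ∈ B) then D x y else (0 : K)) A' =
      doubleCut row col B A' D :=
  cutJ_maskI_eq_doubleCut row col B A' D

/-- **LOCAL QUADRANT CAPTURE.**  At a local maximum `(B,B')` of the double cut, one matrix of rank `≤ 17·doubleCut B B'` agrees with `D`
on every visible cell separated by `B` or by `B'`. -/
theorem localCapture (D : Matrix ι ι' K) (B : Finset (Fin n → Bool)) (B' : Finset (Fin n' → Bool))
    (hloc : IsLocalMax row col D B B') :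
    ∃ N : Matrix ι ι' K, N.rank ≤ 17 * doubleCut row col B B' D ∧
      ∀ x y, colourI (row x) ≠ colourI (col y) → colourJ (row x) ≠ colourJ (col y) →
        ((colourI (row x) ∈ B) ≠ (colourI (col y) ∈ B) ∨ (colourJ (row x) ∈ B') ≠ (colourJ (col y) ∈ B')) →
        N x y = D x y := by
  classical
  set c := doubleCut row col B B' D with hcdef
  -- (1) the `B'`-masked matrix, first-family coloured
  set M₁ : Matrix ι ι' K := maskJ row col B' D with hM₁
  obtain ⟨R₁, hR₁, hL₁⟩ := exists_blockDiagonal_of_localMaxCut (fun x => colourI (row x)) (fun y => colourI (col y)) M₁ B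
    (fun i => by rw [hM₁, bcut_maskJ, bcut_maskJ]; exact (hloc.1 i).1)
    (fun i => by rw [hM₁, bcut_maskJ, bcut_maskJ]; exact (hloc.1 i).2)
  rw [hM₁, bcut_maskJ, ← hM₁] at hL₁
  -- (2) the `B`-masked matrix, second-family coloured
  set M₂ : Matrix ι ι' K := Matrix.of fun x y => if (colourI (row x) ∈ B) ≠ (colourI (col y) ∈ B) then D x y else 0 with hM₂
  obtain ⟨R₂, hR₂, hL₂⟩ := exists_blockDiagonal_of_localMaxCut (fun x => colourJ (row x)) (fun y => colourJ (col y)) M₂ B'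
    (fun j => by rw [hM₂, bcut_maskI, bcut_maskI]; exact (hloc.2 j).1)
    (fun j => by rw [hM₂, bcut_maskI, bcut_maskI]; exact (hloc.2 j).2)
  rw [hM₂, bcut_maskI, ← hM₂] at hL₂
  -- (3) combine
  set L₁ : Matrix ι ι' K := M₁ - R₁ with hL₁def
  set L₂ : Matrix ι ι' K := M₂ - R₂ with hL₂def
  set N₁ : Matrix ι ι' K := Matrix.of fun x y => if (colourJ (row x) ∈ B') ≠ (colourJ (col y) ∈ B') then L₁ x y else 0 with hN₁
  set N₂ : Matrix ι ι' K := Matrix.of fun x y => if (colourI (row x) ∈ B) ≠ (colourI (col y) ∈ B) then L₂ x y else 0 with hN₂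
  set N₃ : Matrix ι ι' K := Matrix.of fun x y => if (colourI (row x) ∈ B) ≠ (colourI (col y) ∈ B) then M₁ x y else 0 with hN₃def
  have hN₃r : N₃.rank ≤ c := by
    have e : N₃ = (Matrix.of fun x y => if colourI (row x) ∈ B ∧ colourI (col y) ∉ B then M₁ x y else 0) +
        (Matrix.of fun x y => if colourI (row x) ∉ B ∧ colourI (col y) ∈ B then M₁ x y else 0) := by
      ext x y
      simp only [hN₃def, Matrix.of_apply, Matrix.add_apply]
      by_cases h1 : colourI (row x) ∈ B <;> by_cases h2 : colourI (col y) ∈ B <;> simp [h1, h2]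
    rw [e]
    exact (rank_add_le' _ _).trans le_rfl
  refine ⟨N₁ + N₂ - N₃, ?_, ?_⟩
  · calc (N₁ + N₂ - N₃).rank ≤ (N₁ + N₂).rank + N₃.rank := rank_sub_le' _ _
      _ ≤ N₁.rank + N₂.rank + N₃.rank := Nat.add_le_add_right (rank_add_le' _ _) _
      _ ≤ 2 * (4 * c) + 2 * (4 * c) + c := by
        refine Nat.add_le_add (Nat.add_le_add ?_ ?_) hN₃r
        · exact (rank_sepMask_le _ _ L₁).trans (Nat.mul_le_mul_left 2 hL₁)
        · exact (rank_sepMask_le _ _ L₂).trans (Nat.mul_le_mul_left 2 hL₂)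
      _ = 17 * c := by ring
  · intro x y hI hJ hsep
    have hI' : (fun x => colourI (row x)) x ≠ (fun y => colourI (col y)) y := hI
    have hJ' : (fun x => colourJ (row x)) x ≠ (fun y => colourJ (col y)) y := hJ
    have r1 : R₁ x y = 0 := hR₁ x y hI'
    have r2 : R₂ x y = 0 := hR₂ x y hJ'
    have m1 : M₁ x y = if (colourJ (row x) ∈ B') ≠ (colourJ (col y) ∈ B') then D x y else 0 := rfl
    have m2 : M₂ x y = if (colourI (row x) ∈ B) ≠ (colourI (col y) ∈ B) then D x y else 0 := rfl
    simp only [Matrix.sub_apply, Matrix.add_apply, hN₁, hN₂, hN₃def, Matrix.of_apply, hL₁def, hL₂def, r1, r2, sub_zero, m1, m2]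
    rcases hsep with h | h
    · by_cases h' : (colourJ (row x) ∈ B') ≠ (colourJ (col y) ∈ B')
      · simp [h, h']
      · simp [h, h']
    · by_cases h' : (colourI (row x) ∈ B) ≠ (colourI (col y) ∈ B)
      · simp [h, h']
      · simp [h, h']

/-! ## Hill-climbing: a local maximum within `c − doubleCut(start)` single moves of any start -/

omit [Fintype ι] [Fintype ι'] [DecidableEq ι] [DecidableEq ι'] in
/-- Erasing one element changes a set by at most that element. -/
theorem card_symmDiff_erase_subset {α : Type} [DecidableEq α] (A : Finset α) (i : α) : symmDiff (A.erase i) A ⊆ {i} := by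
  intro j hj
  simp only [Finset.mem_symmDiff, Finset.mem_erase, Finset.mem_singleton] at hj ⊢
  tauto

omit [Fintype ι] [Fintype ι'] [DecidableEq ι] [DecidableEq ι'] in
/-- Inserting one element changes a set by at most that element. -/
theorem card_symmDiff_insert_subset {α : Type} [DecidableEq α] (A : Finset α) (i : α) : symmDiff (insert i A) A ⊆ {i} := by
  intro j hj
  simp only [Finset.mem_symmDiff, Finset.mem_insert, Finset.mem_singleton] at hj ⊢
  tauto

omit [Fintype ι] [DecidableEq ι] [DecidableEq ι'] in
/-- **Local maxima are near-by.**  If all double cuts are `≤ c`, then from any start `(B₀, B₀')` there is a local maximum `(B, B')` of the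
double cut with `#(B ∆ B₀) + #(B' ∆ B₀') + doubleCut B₀ B₀' ≤ c` (each improving single move raises the integer-valued double cut). -/
theorem exists_localMax_near (D : Matrix ι ι' K) (c : ℕ) (hc : ∀ A A', doubleCut row col A A' D ≤ c) :
    ∀ (B₀ : Finset (Fin n → Bool)) (B₀' : Finset (Fin n' → Bool)),
      ∃ (B : Finset (Fin n → Bool)) (B' : Finset (Fin n' → Bool)), IsLocalMax row col D B B' ∧
        (symmDiff B B₀).card + (symmDiff B' B₀').card + doubleCut row col B₀ B₀' D ≤ c ∧
        doubleCut row col B₀ B₀' D ≤ doubleCut row col B B' D := by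
  classical
  -- induction on the slack `c − doubleCut B₀ B₀'`
  suffices h : ∀ m (B₀ : Finset (Fin n → Bool)) (B₀' : Finset (Fin n' → Bool)), c ≤ doubleCut row col B₀ B₀' D + m →
      ∃ (B : Finset (Fin n → Bool)) (B' : Finset (Fin n' → Bool)), IsLocalMax row col D B B' ∧
        (symmDiff B B₀).card + (symmDiff B' B₀').card + doubleCut row col B₀ B₀' D ≤ c ∧
        doubleCut row col B₀ B₀' D ≤ doubleCut row col B B' D by
    intro B₀ B₀'
    exact h c B₀ B₀' (Nat.le_add_left _ _)
  intro m
  induction m with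
  | zero =>
      intro B₀ B₀' hm
      -- the start is a global maximum value, hence a local max
      have htop : doubleCut row col B₀ B₀' D = c := le_antisymm (hc B₀ B₀') (by simpa using hm)
      refine ⟨B₀, B₀', ⟨fun i => ⟨?_, ?_⟩, fun j => ⟨?_, ?_⟩⟩, by simp [htop], le_rfl⟩
      all_goals rw [htop]; exact hc _ _
  | succ m ih =>
      intro B₀ B₀' hm
      rcases Classical.em (IsLocalMax row col D B₀ B₀') with hloc | hloc
      · exact ⟨B₀, B₀', hloc, by simpa using hc B₀ B₀', le_rfl⟩
      -- some single move strictly increases the double cut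
      have hmove : ∃ (B₁ : Finset (Fin n → Bool)) (B₁' : Finset (Fin n' → Bool)),
          doubleCut row col B₀ B₀' D + 1 ≤ doubleCut row col B₁ B₁' D ∧
          (symmDiff B₁ B₀).card + (symmDiff B₁' B₀').card ≤ 1 := by
        rw [IsLocalMax, not_and_or, not_forall, not_forall] at hloc
        have s0 : ∀ (α : Type) [DecidableEq α] (A : Finset α), (symmDiff A A).card = 0 := by
          intro α _ A; rw [symmDiff_self, Finset.bot_eq_empty, Finset.card_empty]
        rcases hloc with ⟨i, hi⟩ | ⟨j, hj⟩
        · rw [not_and_or, not_le, not_le] at hi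
          rcases hi with h | h
          · refine ⟨B₀.erase i, B₀', Nat.succ_le_of_lt h, ?_⟩
            rw [s0, add_zero]
            exact (Finset.card_le_card (card_symmDiff_erase_subset B₀ i)).trans (Finset.card_singleton i).le
          · refine ⟨insert i B₀, B₀', Nat.succ_le_of_lt h, ?_⟩
            rw [s0, add_zero]
            exact (Finset.card_le_card (card_symmDiff_insert_subset B₀ i)).trans (Finset.card_singleton i).le
        · rw [not_and_or, not_le, not_le] at hj
          rcases hj with h | h
          · refine ⟨B₀, B₀'.erase j, Nat.succ_le_of_lt h, ?_⟩
            rw [s0, zero_add]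
            exact (Finset.card_le_card (card_symmDiff_erase_subset B₀' j)).trans (Finset.card_singleton j).le
          · refine ⟨B₀, insert j B₀', Nat.succ_le_of_lt h, ?_⟩
            rw [s0, zero_add]
            exact (Finset.card_le_card (card_symmDiff_insert_subset B₀' j)).trans (Finset.card_singleton j).le
      obtain ⟨B₁, B₁', hup, hdist⟩ := hmove
      obtain ⟨B, B', hB, hBdist, hBval⟩ := ih B₁ B₁' (by omega)
      refine ⟨B, B', hB, ?_, le_trans (by omega) hBval⟩
      -- triangle inequality for the symmetric difference
      have t1 : (symmDiff B B₀).card ≤ (symmDiff B B₁).card + (symmDiff B₁ B₀).card :=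
        (Finset.card_le_card (symmDiff_triangle B B₁ B₀)).trans (Finset.card_union_le _ _)
      have t2 : (symmDiff B' B₀').card ≤ (symmDiff B' B₁').card + (symmDiff B₁' B₀').card :=
        (Finset.card_le_card (symmDiff_triangle B' B₁' B₀')).trans (Finset.card_union_le _ _)
      omega

/-- **Capturing double cuts exist near any prescribed pair of cuts** (e.g. a balanced one): within `c` single moves of `(B₀,B₀')` there is a
pair `(B,B')` at which one matrix of rank `≤ 17c` agrees with `D` on every visible cell separated by `B` or by `B'`. -/
theorem exists_localCapture_near (D : Matrix ι ι' K) (c : ℕ) (hc : ∀ A A', doubleCut row col A A' D ≤ c)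
    (B₀ : Finset (Fin n → Bool)) (B₀' : Finset (Fin n' → Bool)) :
    ∃ (B : Finset (Fin n → Bool)) (B' : Finset (Fin n' → Bool)) (N : Matrix ι ι' K),
      (symmDiff B B₀).card + (symmDiff B' B₀').card ≤ c ∧ N.rank ≤ 17 * c ∧
      ∀ x y, colourI (row x) ≠ colourI (col y) → colourJ (row x) ≠ colourJ (col y) →
        ((colourI (row x) ∈ B) ≠ (colourI (col y) ∈ B) ∨ (colourJ (row x) ∈ B') ≠ (colourJ (col y) ∈ B')) →
        N x y = D x y := by
  obtain ⟨B, B', hloc, hdist, -⟩ := exists_localMax_near row col D c hc B₀ B₀'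
  obtain ⟨N, hN, hND⟩ := localCapture row col D B B' hloc
  exact ⟨B, B', N, by omega, hN.trans (Nat.mul_le_mul_left 17 (hc B B')), hND⟩

/-! ## Antipodal superadditivity -/

/-- **ANTIPODAL SUPERADDITIVITY.**  For every pair of cuts `(B,B')` and every matrix `L` agreeing with `D` on the visible cells, the
restrictions of `L` to the antipodal quadrants `B×B'` and `Bᶜ×B'ᶜ` satisfy
`rank L|₁₁ + rank L|₂₂ ≤ rank L + rank R(B,B') + rank R(Bᶜ,B'ᶜ)`: the cells between the two quadrants are all visible and form exactly the two
rectangles, and rank is additive over blocks in disjoint rows and columns.  Hence `mc(D) ≥ mc(Q₁₁) + mc(Q₂₂) − doubleCut B B'`. -/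
theorem rank_quadrants_le (D L : Matrix ι ι' K) (B : Finset (Fin n → Bool)) (B' : Finset (Fin n' → Bool))
    (hL : ∀ x y, colourI (row x) ≠ colourI (col y) → colourJ (row x) ≠ colourJ (col y) → L x y = D x y) :
    (Matrix.of fun x y => if (colourI (row x) ∈ B ∧ colourJ (row x) ∈ B') ∧ (colourI (col y) ∈ B ∧ colourJ (col y) ∈ B')
        then L x y else 0).rank +
    (Matrix.of fun x y => if (colourI (row x) ∉ B ∧ colourJ (row x) ∉ B') ∧ (colourI (col y) ∉ B ∧ colourJ (col y) ∉ B')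
        then L x y else 0).rank ≤
      L.rank + (rect row col B B' true true D).rank + (rect row col B B' false false D).rank := by
  classical
  -- row / column types in the union of the two antipodal quadrants
  set M : Matrix ι ι' K := Matrix.of fun x y =>
    if ((colourI (row x) ∈ B ∧ colourJ (row x) ∈ B') ∨ (colourI (row x) ∉ B ∧ colourJ (row x) ∉ B')) ∧
        ((colourI (col y) ∈ B ∧ colourJ (col y) ∈ B') ∨ (colourI (col y) ∉ B ∧ colourJ (col y) ∉ B')) then L x y else 0 with hM
  set L₁₁ : Matrix ι ι' K := Matrix.of fun x y =>
    if (colourI (row x) ∈ B ∧ colourJ (row x) ∈ B') ∧ (colourI (col y) ∈ B ∧ colourJ (col y) ∈ B') then L x y else 0 with hL₁₁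
  set L₂₂ : Matrix ι ι' K := Matrix.of fun x y =>
    if (colourI (row x) ∉ B ∧ colourJ (row x) ∉ B') ∧ (colourI (col y) ∉ B ∧ colourJ (col y) ∉ B') then L x y else 0 with hL₂₂
  set E : Matrix ι ι' K := rect row col B B' true true D with hE
  set F : Matrix ι ι' K := rect row col B B' false false D with hF
  have hMdec : M = (L₁₁ + L₂₂) + (E + F) := by
    ext x y
    rw [Matrix.add_apply, Matrix.add_apply, Matrix.add_apply, hM, hL₁₁, hL₂₂, hE, hF, rect_apply, rect_apply,
      Matrix.of_apply, Matrix.of_apply, Matrix.of_apply]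
    simp only [Bool.not_true, Bool.not_false, decide_eq_true_eq, decide_eq_false_iff_not]
    by_cases a1 : colourI (row x) ∈ B <;> by_cases a2 : colourJ (row x) ∈ B' <;>
      by_cases b1 : colourI (col y) ∈ B <;> by_cases b2 : colourJ (col y) ∈ B' <;>
      simp only [a1, a2, b1, b2, and_true, and_false, or_true, or_false,
        if_true, if_false, not_true_eq_false, not_false_eq_true, add_zero, zero_add]
    · -- row in 11, column in 22: visible, the entry of `R(B,B')`
      exact hL x y (fun h => b1 (h ▸ a1)) (fun h => b2 (h ▸ a2))
    · -- row in 22, column in 11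
      exact hL x y (fun h => a1 (h ▸ b1)) (fun h => a2 (h ▸ b2))
  have hadd : (L₁₁ + L₂₂).rank = L₁₁.rank + L₂₂.rank := by
    refine rank_add_of_disjoint (fun x => colourI (row x) ∈ B ∧ colourJ (row x) ∈ B')
      (fun y => colourI (col y) ∈ B ∧ colourJ (col y) ∈ B') L₁₁ L₂₂ ?_ ?_
    · intro x y h; rw [hL₁₁, Matrix.of_apply, if_neg h]
    · intro x y h
      rw [hL₂₂, Matrix.of_apply, if_neg]
      rintro ⟨⟨h1, h2⟩, h3, h4⟩
      exact h ⟨fun hh => h1 hh.1, fun hh => h3 hh.1⟩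
  have hML : M.rank ≤ L.rank := rank_mask_le _ _ L
  have h1 : L₁₁ + L₂₂ = M - (E + F) := by rw [hMdec]; abel
  calc L₁₁.rank + L₂₂.rank = (L₁₁ + L₂₂).rank := hadd.symm
    _ = (M - (E + F)).rank := by rw [h1]
    _ ≤ M.rank + (E + F).rank := rank_sub_le' _ _
    _ ≤ L.rank + (E.rank + F.rank) := Nat.add_le_add hML (rank_add_le' _ _)
    _ = L.rank + E.rank + F.rank := (Nat.add_assoc _ _ _).symm

/-- **QUADRANT CAPTURE AT ANY DOUBLE CUT** (appended, lead g14).  For EVERY `(B,B')`, one matrix of rank `≤ 17c` (`c` = the bound on all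
double cuts) agrees with `D` on every visible cell separated by `B` or by `B'`: each masked matrix is an honest one-family instance with all
cuts `≤ c`, decomposed at ITS OWN maximiser (`exists_blockDiagonal_of_cuts_le`); so the cut of a recursion may be chosen freely. -/
theorem captureAt (D : Matrix ι ι' K) (c : ℕ) (hc : ∀ A A', doubleCut row col A A' D ≤ c)
    (B : Finset (Fin n → Bool)) (B' : Finset (Fin n' → Bool)) :
    ∃ N : Matrix ι ι' K, N.rank ≤ 17 * c ∧
      ∀ x y, colourI (row x) ≠ colourI (col y) → colourJ (row x) ≠ colourJ (col y) →
        ((colourI (row x) ∈ B) ≠ (colourI (col y) ∈ B) ∨ (colourJ (row x) ∈ B') ≠ (colourJ (col y) ∈ B')) →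
        N x y = D x y := by
  classical
  -- (1) the `B'`-masked matrix, first-family coloured: all its bipartition cuts are double cuts
  set M₁ : Matrix ι ι' K := maskJ row col B' D with hM₁
  obtain ⟨R₁, hR₁, hL₁⟩ :=
    Summit.PneNP.PneNP.Theorems.CnfIdealGenLengthRankDefectRepresentationsDoubleMaxCutTwoClasses.exists_blockDiagonal_of_cuts_le
      (fun x => colourI (row x)) (fun y => colourI (col y)) M₁ c (fun A => hc A B')
  -- (2) the `B`-masked matrix, second-family coloured
  set M₂ : Matrix ι ι' K := Matrix.of fun x y => if (colourI (row x) ∈ B) ≠ (colourI (col y) ∈ B) then D x y else 0 with hM₂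
  obtain ⟨R₂, hR₂, hL₂⟩ :=
    Summit.PneNP.PneNP.Theorems.CnfIdealGenLengthRankDefectRepresentationsDoubleMaxCutTwoClasses.exists_blockDiagonal_of_cuts_le
      (fun x => colourJ (row x)) (fun y => colourJ (col y)) M₂ c
      (fun A' => by rw [hM₂, cutJ_maskI_eq_doubleCut]; exact hc B A')
  -- (3) combine
  set L₁ : Matrix ι ι' K := M₁ - R₁ with hL₁def
  set L₂ : Matrix ι ι' K := M₂ - R₂ with hL₂def
  set N₁ : Matrix ι ι' K := Matrix.of fun x y => if (colourJ (row x) ∈ B') ≠ (colourJ (col y) ∈ B') then L₁ x y else 0 with hN₁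
  set N₂ : Matrix ι ι' K := Matrix.of fun x y => if (colourI (row x) ∈ B) ≠ (colourI (col y) ∈ B) then L₂ x y else 0 with hN₂
  set N₃ : Matrix ι ι' K := Matrix.of fun x y => if (colourI (row x) ∈ B) ≠ (colourI (col y) ∈ B) then M₁ x y else 0 with hN₃def
  have hN₃r : N₃.rank ≤ c := by
    have e : N₃ = (Matrix.of fun x y => if colourI (row x) ∈ B ∧ colourI (col y) ∉ B then M₁ x y else 0) +
        (Matrix.of fun x y => if colourI (row x) ∉ B ∧ colourI (col y) ∈ B then M₁ x y else 0) := by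
      ext x y; simp only [hN₃def, Matrix.of_apply, Matrix.add_apply]
      by_cases h1 : colourI (row x) ∈ B <;> by_cases h2 : colourI (col y) ∈ B <;> simp [h1, h2]
    rw [e]; exact (rank_add_le' _ _).trans (hc B B')
  refine ⟨N₁ + N₂ - N₃, ?_, ?_⟩
  · calc (N₁ + N₂ - N₃).rank ≤ (N₁ + N₂).rank + N₃.rank := rank_sub_le' _ _
      _ ≤ N₁.rank + N₂.rank + N₃.rank := Nat.add_le_add_right (rank_add_le' _ _) _
      _ ≤ 2 * (4 * c) + 2 * (4 * c) + c := by
        refine Nat.add_le_add (Nat.add_le_add ?_ ?_) hN₃r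
        · exact (rank_sepMask_le _ _ L₁).trans (Nat.mul_le_mul_left 2 hL₁)
        · exact (rank_sepMask_le _ _ L₂).trans (Nat.mul_le_mul_left 2 hL₂)
      _ = 17 * c := by ring
  · intro x y hI hJ hsep
    have hI' : (fun x => colourI (row x)) x ≠ (fun y => colourI (col y)) y := hI
    have hJ' : (fun x => colourJ (row x)) x ≠ (fun y => colourJ (col y)) y := hJ
    have r1 : R₁ x y = 0 := hR₁ x y hI'
    have r2 : R₂ x y = 0 := hR₂ x y hJ'
    have m1 : M₁ x y = if (colourJ (row x) ∈ B') ≠ (colourJ (col y) ∈ B') then D x y else 0 := rfl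
    have m2 : M₂ x y = if (colourI (row x) ∈ B) ≠ (colourI (col y) ∈ B) then D x y else 0 := rfl
    simp only [Matrix.sub_apply, Matrix.add_apply, hN₁, hN₂, hN₃def, Matrix.of_apply, hL₁def, hL₂def, r1, r2, sub_zero, m1, m2]
    rcases hsep with h | h
    · by_cases h' : (colourJ (row x) ∈ B') ≠ (colourJ (col y) ∈ B') <;> simp [h, h']
    · by_cases h' : (colourI (row x) ∈ B) ≠ (colourI (col y) ∈ B) <;> simp [h, h']

end Capture

end Summit.PneNP.PneNP.Theorems.CnfIdealGenLengthRankDefectRepresentationsLocalCapture
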